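import Summits.BirchSwinnertonDyer.BirchSwinnertonDyer.Theorems.ByReductionTypeAtTwoAdditivePotGoodPrintKrizLi92b1Base
import Summits.BirchSwinnertonDyer.BirchSwinnertonDyer.Theorems.GenusKolyvaginAtTwoMinimalTwinBSDTwoKrizLiAnchor37a1Base
import Literature.NumberTheory.EllipticCurves.OrdinaryPrimesProofs
import Literature.NumberTheory.EllipticCurves.LeadingTermTamagawaProofs
import Mathlib.Tactic.NormNum.LegendreSymbol
import HarnessLib

/-!
# Route `GenusKolyvaginAtTwo`, crux U₂ `MinimalTwinBSDTwo` (stmt-BirchSwinnertonDyer-22985), LINE 23 «twin_swap»: KERNEL data of the Kriz–Li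
# RANK-**ZERO** ANCHOR `37b1 = [0,1,1,-23,-50]` (Cremona Table 1 «37 37B1»: `N = 37`, `r = 0`, `E(ℚ) ≅ ℤ/3`, `Δ = 50653`, `I3` at `37`, GOOD at `2`;
# Kriz–Li §6 TABLE 2 row `37b1 | −7 | 1 | ✓`) over `K = ℚ(√−7)` — ellipticity, global minimality, `E[2]` irreducible (the `2`-division cubic
# `X³ + (4)X² + (-368)X + (-3184)` has no root mod `3`), good reduction at `2` with `c₂ = 1`, non-CM, `N = 37` EXACTLY; the partner
# `37b1^{(−7)} = [0,-7,1,-1127,17064]` (`I₀*` at `7`, `I3` at `37`: `N = 7²·37 = 1813 < 5000`); the packet witness `ℓ = 53` (`#Ẽ(𝔽_53) = 57`, `a_53 = -3` odd)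

Seat `bsd-line-gk2-p2` g35 (PROVER 2/3, cell `bsd-f1-sign2`; LINE 23 holder), `--supports stmt-BirchSwinnertonDyer-22985` (helper; closes nothing).
KERNEL THEOREMS ONLY (0 `def`, 0 `sorry`, no named fact); standard axioms.  Companion of `…KrizLiAnchor11a1Base.lean` (this seat, g35: the first
RANK-ZERO Table-2 anchor) and of `…KrizLiAnchor37a1Base/43a1Base.lean` (g34: rank-one Table-1 anchors with `d_K²·N < 5000`): `37b1` is a rank-ZERO row of
Kriz–Li's Table 2 that is GOOD at `2` with `c₂ = 1` and `49·N = 1813 < 5000`, so BOTH numerical `BSD(2)` inputs of Kriz–Li Thm 5.1 (2) (the base and its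
companion `37b1^{(−7)}`) lie in Creutz–Miller's range and `BSD₂` on the whole packet `{37b1^{(d)}, 37b1^{(−7d)} : d ∈ 𝒩, χ_d(−37) = 1}` follows from PRINT
ALONE (road file `…KrizLiAnchor37b1.lean`); the RANK-ONE half (`37b1^{(−7d)}` and the partner) consists of U₂-class curves.  Tate certificate at `7` for
the partner: the b2b engine `DeepCert` (exit `6` = `I₀*`, translation `t = 24`).  Closes nothing; nothing booked; **BSD is NOT proved by any of this;
U₂ is NOT proved.**

References: [KrizLi2019] Thm 5.1 (2), Def 4.1, §6 Example 6.5 and Table 2 (row 37b1, arXiv:1606.03172v3 Congruence.tex l. 1044); [CremonaAlgorithms1997]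
Table 1 (37B1; 1813); [SilvermanAEC2009] III.2.3, VII.1, VII.5, X.5, App. C §11; [Silverman1994] IV.9.4, IV.11.1; [Kraus1989] Prop. 1–2.
-/

set_option autoImplicit false
-- the Theorems namespace of this sub repeats the summit name by design (D-0017 nested layout)
set_option linter.dupNamespace false

noncomputable section

open scoped Classical NumberField

open WeierstrassCurve IsDedekindDomain Rat.HeightOneSpectrum Literature.NumberTheory.EllipticCurves
  Literature.NumberTheory.EllipticCurves.ModularForms
  Literature.NumberTheory.EllipticCurves.Rank1Residual
  Literature.NumberTheory.DiophantineGeometry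
  Summit.BirchSwinnertonDyer
  Summit.BirchSwinnertonDyer.Rank1Residual
  Summit.BirchSwinnertonDyer.Rank1Residual.X11b
  Summit.BirchSwinnertonDyer.Rank1Residual.X5.O1
  Summit.BirchSwinnertonDyer.Rank1Residual.P2
  Summit.BirchSwinnertonDyer.BirchSwinnertonDyer.Rank1Residual.IntModel
  Summit.BirchSwinnertonDyer.BirchSwinnertonDyer.Theorems
  Summit.BirchSwinnertonDyer.BirchSwinnertonDyer.Theorems.AddPotGoodPrint
  Summit.BirchSwinnertonDyer.BirchSwinnertonDyer.Rank2Observatory.Tate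

namespace Summit.BirchSwinnertonDyer.BirchSwinnertonDyer.Theorems.GenusExact.TwinSwap.KrizLiAnchor37b1

/-! ## §1 The anchor `37b1 = [0,1,1,-23,-50]`: `Δ = 50653`, `c₄ = 1120`, GOOD at `2`, `I3` at `37` -/
section Base37B1

/-- `37b1 = [0,1,1,-23,-50]` is an elliptic curve (`Δ = 50653 ≠ 0`). [cite: CremonaAlgorithms1997, Table 1 (37B1)] -/
theorem isElliptic_37B1 : (⟨0, 1, 1, -23, -50⟩ : WeierstrassCurve ℚ).IsElliptic := ⟨by
  rw [isUnit_iff_ne_zero]; norm_num [WeierstrassCurve.Δ, WeierstrassCurve.b₂, WeierstrassCurve.b₄, WeierstrassCurve.b₆, WeierstrassCurve.b₈]⟩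

/-- `37b1` is GLOBALLY MINIMAL (`|Δ| = 37^3`). [cite: SilvermanAEC2009, VII.1 Remark 1.1] [cite: Kraus1989, Prop. 1 and Prop. 2] -/
theorem isGloballyMinimal_37B1 : (⟨0, 1, 1, -23, -50⟩ : WeierstrassCurve ℚ).IsGloballyMinimal :=
  isGloballyMinimal_of_krausCriterion_support (0) (1) (1) (-23) (-50) [(37, 0, 3)]
    (by intro t ht; simp only [List.mem_cons, List.not_mem_nil, or_false] at ht
        rcases ht with rfl; norm_num)
    (by decide +kernel) (by decide +kernel)

/-- `Δ(37b1) = 50653` on the integer model. [cite: CremonaAlgorithms1997, Table 1 (37B1)] -/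
theorem M37B1_Δ : (⟨0, 1, 1, -23, -50⟩ : WeierstrassCurve ℤ).Δ = 50653 := by decide +kernel
/-- `c₄(37b1) = 1120` on the integer model. [cite: CremonaAlgorithms1997, Table 1 (37B1)] -/
theorem M37B1_c₄ : (⟨0, 1, 1, -23, -50⟩ : WeierstrassCurve ℤ).c₄ = 1120 := by decide +kernel

/-- The integer model of `37b1` is Cremona's. [cite: SilvermanAEC2009, VIII.8] -/
theorem intModel_37B1 :
    haveI := isElliptic_37B1; haveI := isGloballyMinimal_37B1
    integralModelInt (⟨0, 1, 1, -23, -50⟩ : WeierstrassCurve ℚ) = (⟨0, 1, 1, -23, -50⟩ : WeierstrassCurve ℤ) :=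
  haveI := isElliptic_37B1; haveI := isGloballyMinimal_37B1
  integralModelInt_eq_of_map_eq _ (by ext <;> simp [WeierstrassCurve.map])

/-- The integer model base-changed to `ℚ` is the rational model. [folklore] -/
theorem baseChange_int_37B1 : (⟨0, 1, 1, -23, -50⟩ : WeierstrassCurve ℤ).baseChange ℚ = (⟨0, 1, 1, -23, -50⟩ : WeierstrassCurve ℚ) := by
  ext <;> simp [WeierstrassCurve.baseChange, WeierstrassCurve.map]

/-- `b₂, b₄, b₆` of `37b1`. [cite: SilvermanAEC2009, III.1] -/
theorem b_37B1 : (⟨0, 1, 1, -23, -50⟩ : WeierstrassCurve ℚ).b₂ = ((4 : ℤ) : ℚ) ∧ (⟨0, 1, 1, -23, -50⟩ : WeierstrassCurve ℚ).b₄ = ((-46 : ℤ) : ℚ) ∧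
    (⟨0, 1, 1, -23, -50⟩ : WeierstrassCurve ℚ).b₆ = ((-199 : ℤ) : ℚ) := by
  simp only [WeierstrassCurve.b₂, WeierstrassCurve.b₄, WeierstrassCurve.b₆]; norm_num

/-- **`E[2]` irreducible for `37b1`** (`E(ℚ)[2] = 0`; Cremona: `E(ℚ) ≅ ℤ/3`): the monic `2`-division cubic `X³ + (4)X² + (-368)X + (-3184)` has no root modulo `3`.
[cite: SilvermanAEC2009, III.2.3 (b)] [cite: KrizLi2019, Thm. 5.1 (hypothesis E(ℚ)[2] = 0) and §6 Example 6.5] -/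
theorem irr_two_37B1 :
    haveI := isElliptic_37B1
    Irr (⟨0, 1, 1, -23, -50⟩ : WeierstrassCurve ℚ) 2 :=
  haveI := isElliptic_37B1
  irr_two_of_forall_cubic_ne _ b_37B1.1 b_37B1.2.1 b_37B1.2.2 (ℓ := 3) (by decide)

/-- **`E(ℚ)[2] = 0` for `37b1`** in Kriz–Li's shape. [cite: KrizLi2019, Thm. 5.1 hypothesis "E(ℚ)[2] = 0"] -/
theorem twoTorsion_37B1 :
    haveI := isElliptic_37B1
    ∀ Q : (⟨0, 1, 1, -23, -50⟩ : WeierstrassCurve ℚ).toAffine.Point, 2 • Q = 0 → Q = 0 :=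
  haveI := isElliptic_37B1
  (X5.O1.irr_two_iff_forall_two_nsmul _).mp irr_two_37B1

/-- **`37b1` has GOOD reduction at `2`** (`2 ∤ Δ_min = 50653`). [cite: SilvermanAEC2009, VII.5 Prop. 5.1 (a)] [cite: KrizLi2019, §6 Table 2 (row 37b1: c₂ = 1)] -/
theorem hasGoodReductionAtPrime_two_37B1 :
    haveI := isGloballyMinimal_37B1; haveI : Fact (Nat.Prime 2) := ⟨Nat.prime_two⟩
    (⟨0, 1, 1, -23, -50⟩ : WeierstrassCurve ℚ).HasGoodReductionAtPrime 2 := by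
  haveI := isElliptic_37B1; haveI := isGloballyMinimal_37B1
  haveI : Fact (Nat.Prime 2) := ⟨Nat.prime_two⟩
  refine hasGoodReductionAtPrime_of_not_dvd _ 2 ?_
  rw [minimalDiscriminantInt_eq intModel_37B1, M37B1_Δ]; decide

/-- **`c₂(37b1) = 1`** (good reduction: Tate's Step 1). [cite: SilvermanAEC2009, VII.2 remark after Prop. 2.1] [cite: KrizLi2019, §6 Table 2 (row 37b1: c₂ = 1)] -/
theorem localTamagawaNumber_two_37B1 :
    haveI : Fact (Nat.Prime 2) := ⟨Nat.prime_two⟩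
    ((⟨0, 1, 1, -23, -50⟩ : WeierstrassCurve ℚ).baseChange ℚ_[2]).localTamagawaNumber ℤ_[2] = 1 :=
  haveI := isGloballyMinimal_37B1
  haveI : Fact (Nat.Prime 2) := ⟨Nat.prime_two⟩
  localTamagawaNumber_padic_eq_one_of_good_holds _ 2 hasGoodReductionAtPrime_two_37B1

/-- **`c₂(37b1)` is ODD** (`= 1`). [cite: KrizLi2019, Thm. 5.1 (hypothesis "c₂(E) odd") and §6 Table 2 (row 37b1)] -/
theorem odd_localTamagawaNumber_two_37B1 :
    haveI : Fact (Nat.Prime 2) := ⟨Nat.prime_two⟩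
    Odd (((⟨0, 1, 1, -23, -50⟩ : WeierstrassCurve ℚ).baseChange ℚ_[2]).localTamagawaNumber ℤ_[2]) := by
  rw [localTamagawaNumber_two_37B1]; exact odd_one

/-- **`37b1` is non-CM**: multiplicative at `37` (`37 ∣ Δ`, `37 ∤ c₄ = 1120`), so `ord_37 j < 0` (`j = 2¹⁵·5³·7³/37³`). [cite: SilvermanAEC2009, App. C §11] -/
theorem not_hasCM_37B1 :
    haveI := isElliptic_37B1
    ¬ (⟨0, 1, 1, -23, -50⟩ : WeierstrassCurve ℚ).HasCM := by
  haveI := isElliptic_37B1; haveI := isGloballyMinimal_37B1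
  haveI : Fact (Nat.Prime 37) := ⟨by norm_num⟩
  exact AdditivePotMult.not_hasCM_of_padicValRat_j_neg (p := 37) (EisensteinPrimes.padicValRat_j_neg_of_mult _ 37
    (hasMultiplicativeReductionAtPrime_of_intModel intModel_37B1 37 (by rw [M37B1_Δ]; decide) (by rw [M37B1_c₄]; decide)))

/-- **`N(37b1) ∣ |Δ_min| = 50653`.** [cite: SilvermanAEC2009, VIII.11 and C.16] -/
theorem conductorNorm_dvd_37B1 :
    haveI := isElliptic_37B1
    (⟨0, 1, 1, -23, -50⟩ : WeierstrassCurve ℚ).conductorNorm ℤ ∣ 50653 := by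
  haveI := isElliptic_37B1; haveI := isGloballyMinimal_37B1
  have hdvd := WeierstrassCurve.conductorNorm_dvd_minimalDiscriminantNorm (⟨0, 1, 1, -23, -50⟩ : WeierstrassCurve ℚ)
    (WeierstrassCurve.finite_setOf_ordMinimalDiscriminant_ne_zero_holds _)
  rw [WeierstrassCurve.minimalDiscriminantNorm_int_eq_natAbs_minimalDiscriminantInt_holds,
    minimalDiscriminantInt_eq intModel_37B1, M37B1_Δ] at hdvd
  exact hdvd

/-- **`ord_37 N(37b1) = 1`** (multiplicative at `37`). [cite: Silverman1994, IV.11.1] -/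
theorem factorization_conductorNorm_37B1 :
    haveI := isElliptic_37B1
    ((⟨0, 1, 1, -23, -50⟩ : WeierstrassCurve ℚ).conductorNorm ℤ).factorization 37 = 1 := by
  haveI := isElliptic_37B1; haveI := isGloballyMinimal_37B1
  haveI hE : ((⟨0, 1, 1, -23, -50⟩ : WeierstrassCurve ℤ).baseChange ℚ).IsElliptic := by rw [baseChange_int_37B1]; infer_instance
  have hN : Nat.Prime 37 := by norm_num
  set v : HeightOneSpectrum ℤ := (primesEquiv (R := ℤ)).symm ⟨37, hN⟩ with hv
  have hgen : natGenerator v = 37 := congrArg Subtype.val ((primesEquiv (R := ℤ)).apply_symm_apply ⟨37, hN⟩)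
  have hmin : ((⟨0, 1, 1, -23, -50⟩ : WeierstrassCurve ℤ).baseChange ℚ).IsMinimalAt v := by
    rw [baseChange_int_37B1]; exact IsGloballyMinimal.isMinimalAt_int _ v
  have h1 : ((⟨0, 1, 1, -23, -50⟩ : WeierstrassCurve ℤ).baseChange ℚ).conductorExponent v = 1 :=
    conductorExponent_eq_one_of_dvd_Δ_of_not_dvd_c₄ hmin (by rw [hgen, M37B1_Δ]; decide) (by rw [hgen, M37B1_c₄]; decide)
  rw [baseChange_int_37B1] at h1
  rw [show (37 : ℕ) = ((⟨37, hN⟩ : Nat.Primes) : ℕ) from rfl, factorization_conductorNorm_primesEquiv_symm]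
  exact h1

/-- **`N(37b1) = 37` IN THE KERNEL** (`N ∣ 37^3`, `N` has no prime factor other than `37`, `ord_37 N = 1`). [cite: CremonaAlgorithms1997, Table 1 (37B1)] -/
theorem conductorNorm_37B1 :
    haveI := isElliptic_37B1
    (⟨0, 1, 1, -23, -50⟩ : WeierstrassCurve ℚ).conductorNorm ℤ = 37 := by
  haveI := isElliptic_37B1
  set M := (⟨0, 1, 1, -23, -50⟩ : WeierstrassCurve ℚ).conductorNorm ℤ with hM
  have hM0 : M ≠ 0 := (conductorNorm_pos_holds _).ne'
  have hp : Nat.Prime 37 := by norm_num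
  have h1 := factorization_conductorNorm_37B1
  have hle := (Nat.factorization_le_iff_dvd hM0 (by norm_num : (50653 : ℕ) ≠ 0)).mpr conductorNorm_dvd_37B1
  have eΔ : (50653 : ℕ) = 37 ^ 3 := by norm_num
  refine Nat.eq_of_factorization_eq hM0 hp.ne_zero fun q => ?_
  rw [hp.factorization, Finsupp.single_apply]
  by_cases hq : 37 = q
  · subst hq; rw [if_pos rfl]; exact h1
  · rw [if_neg hq]
    have hq' := hle q
    rw [eΔ, Nat.factorization_pow, Finsupp.smul_apply, hp.factorization, Finsupp.single_apply, if_neg hq, smul_zero] at hq'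
    exact Nat.le_zero.mp hq'

/-- `N(37b1) ≠ 0` as an instance witness. [cite: CremonaAlgorithms1997, Table 1 (37B1)] -/
theorem neZero_conductorNorm_37B1 :
    haveI := isElliptic_37B1
    NeZero ((⟨0, 1, 1, -23, -50⟩ : WeierstrassCurve ℚ).conductorNorm ℤ) :=
  ⟨by rw [conductorNorm_37B1]; norm_num⟩

/-- **`N(37b1) < 5000`** (Creutz–Miller's range). [cite: CreutzMiller2012, Thm. 1.1] -/
theorem conductorNorm_lt_5000_37B1 :
    haveI := isElliptic_37B1
    (⟨0, 1, 1, -23, -50⟩ : WeierstrassCurve ℚ).conductorNorm ℤ < 5000 := by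
  rw [conductorNorm_37B1]; norm_num

end Base37B1

/-! ## §2 The partner `T′ = 37b1^{(−7)} = [0,-7,1,-1127,17064]`: global minimal, `Δ = 5959274797` (`7⁶·37^3` up to sign), `N(T′) = 7²·37 = 1813 < 5000` -/
section Partner37B1

/-- **The tree's quadratic twist `37b1^{(−7)}` IS `[0, -7, 0, -1127, 68257 / 4]`** (`(b₂, b₄, b₆) = (4, -46, -199)`). [cite: SilvermanAEC2009, X.5 Cor. 5.4] -/
theorem quadraticTwist_neg7_37B1 :
    (⟨0, 1, 1, -23, -50⟩ : WeierstrassCurve ℚ).quadraticTwist (-7) = (⟨0, -7, 0, -1127, 68257 / 4⟩ : WeierstrassCurve ℚ) := by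
  ext <;> norm_num [WeierstrassCurve.quadraticTwist, WeierstrassCurve.b₂, WeierstrassCurve.b₄, WeierstrassCurve.b₆]

/-- **`(1, 0, 0, ½) • 37b1^{(−7)} = [0,-7,1,-1127,17064]`** — an integral minimal model of the companion (complete the square back: `y ↦ y + ½`).
[cite: SilvermanAEC2009, III.1 Table 3.1 and X.5 Cor. 5.4] -/
theorem smul_quadraticTwist_neg7_37B1 :
    (⟨1, 0, 0, (1 : ℚ) / 2⟩ : VariableChange ℚ) • (⟨0, 1, 1, -23, -50⟩ : WeierstrassCurve ℚ).quadraticTwist (-7) = (⟨0, -7, 1, -1127, 17064⟩ : WeierstrassCurve ℚ) := by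
  rw [quadraticTwist_neg7_37B1]
  ext <;> norm_num [variableChange_a₁, variableChange_a₂, variableChange_a₃, variableChange_a₄, variableChange_a₆]

/-- `T′ = [0,-7,1,-1127,17064]` is an elliptic curve (`Δ = 5959274797 ≠ 0`). [cite: SilvermanAEC2009, III.1] -/
theorem isElliptic_T37B1 : (⟨0, -7, 1, -1127, 17064⟩ : WeierstrassCurve ℚ).IsElliptic := ⟨by
  rw [isUnit_iff_ne_zero]; norm_num [WeierstrassCurve.Δ, WeierstrassCurve.b₂, WeierstrassCurve.b₄, WeierstrassCurve.b₆, WeierstrassCurve.b₈]⟩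

/-- `T′` is GLOBALLY MINIMAL (`|Δ| = 7⁶·37^3`: `v_p Δ < 12` everywhere). [cite: SilvermanAEC2009, VII.1 Remark 1.1] [cite: Kraus1989, Prop. 1 and Prop. 2] -/
theorem isGloballyMinimal_T37B1 : (⟨0, -7, 1, -1127, 17064⟩ : WeierstrassCurve ℚ).IsGloballyMinimal :=
  isGloballyMinimal_of_krausCriterion_support (0) (-7) (1) (-1127) (17064) [(7, 0, 6), (37, 0, 3)]
    (by intro t ht; simp only [List.mem_cons, List.not_mem_nil, or_false] at ht
        rcases ht with rfl | rfl <;> norm_num)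
    (by decide +kernel) (by decide +kernel)

/-- `Δ(T′) = 5959274797`. [cite: CremonaAlgorithms1997, Table 1 (conductor 1813)] -/
theorem MT37B1_Δ : (⟨0, -7, 1, -1127, 17064⟩ : WeierstrassCurve ℤ).Δ = 5959274797 := by decide +kernel
/-- `c₄(T′) = 54880`. [cite: CremonaAlgorithms1997, Table 1 (conductor 1813)] -/
theorem MT37B1_c₄ : (⟨0, -7, 1, -1127, 17064⟩ : WeierstrassCurve ℤ).c₄ = 54880 := by decide +kernel

/-- The integer model base-changed to `ℚ` is the rational model. [folklore] -/
theorem baseChange_int_T37B1 :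
    (⟨0, -7, 1, -1127, 17064⟩ : WeierstrassCurve ℤ).baseChange ℚ = (⟨0, -7, 1, -1127, 17064⟩ : WeierstrassCurve ℚ) := by
  ext <;> simp [WeierstrassCurve.baseChange, WeierstrassCurve.map]

/-- The integer model of `T′`. [cite: SilvermanAEC2009, VIII.8] -/
theorem intModel_T37B1 :
    haveI := isElliptic_T37B1; haveI := isGloballyMinimal_T37B1
    integralModelInt (⟨0, -7, 1, -1127, 17064⟩ : WeierstrassCurve ℚ) = (⟨0, -7, 1, -1127, 17064⟩ : WeierstrassCurve ℤ) :=
  haveI := isElliptic_T37B1; haveI := isGloballyMinimal_T37B1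
  integralModelInt_eq_of_map_eq _ (by ext <;> simp [WeierstrassCurve.map])

/-- **`N(T′) ∣ |Δ_min| = 5959274797`.** [cite: SilvermanAEC2009, VIII.11 and C.16] -/
theorem conductorNorm_dvd_T37B1 :
    haveI := isElliptic_T37B1
    (⟨0, -7, 1, -1127, 17064⟩ : WeierstrassCurve ℚ).conductorNorm ℤ ∣ 5959274797 := by
  haveI := isElliptic_T37B1; haveI := isGloballyMinimal_T37B1
  have hdvd := WeierstrassCurve.conductorNorm_dvd_minimalDiscriminantNorm (⟨0, -7, 1, -1127, 17064⟩ : WeierstrassCurve ℚ)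
    (WeierstrassCurve.finite_setOf_ordMinimalDiscriminant_ne_zero_holds _)
  rw [WeierstrassCurve.minimalDiscriminantNorm_int_eq_natAbs_minimalDiscriminantInt_holds,
    minimalDiscriminantInt_eq intModel_T37B1, MT37B1_Δ] at hdvd
  exact hdvd

/-- **Tate certificate for `T′` at `7`, kernel check** (Steps 1–6): translate by `(r,s,t) = (0,0,24)` to `[0,−7,49,−1127,16464]` (`7 ∣ a₂`, `7² ∣ a₃, a₄`,
`7³ ∣ a₆`); Step 6 exit: the cubic `T³ − T² − 23T + 48` has distinct roots mod `7` (discriminant `7053 ≢ 0`) — type `I₀*`, `v₇(Δ) = 6`.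
[cite: Silverman1994, IV.9.4 Steps 1–6] -/
theorem tateDeepCheck_seven_T37B1 : DeepCert.check ⟨7, 0, 0, 24, 6, 6, 0⟩ ⟨0, -7, 1, -1127, 17064⟩ = true := by
  decide +kernel

/-- **`f₇(T′) = 2`** (Ogg: `6 + 1 − 5` components of `I₀*`). [cite: Silverman1994, IV.11.1] -/
theorem conductorExponent_seven_T37B1 (v : HeightOneSpectrum ℤ) (hv : natGenerator v = 7) :
    (⟨0, -7, 1, -1127, 17064⟩ : WeierstrassCurve ℚ).conductorExponent v = 2 := by
  have h := DeepCert.conductorExponent_int_eq (W₀ := ⟨0, -7, 1, -1127, 17064⟩) (c := ⟨7, 0, 0, 24, 6, 6, 0⟩) v hv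
    (by rw [baseChange_int_T37B1]; exact isGloballyMinimal_T37B1) tateDeepCheck_seven_T37B1
  rw [baseChange_int_T37B1] at h
  exact h

/-- **`ord₇ N(T′) = 2`, `ord_37 N(T′) = 1`** (the latter: multiplicative at `37`, `37 ∣ Δ`, `37 ∤ c₄ = 54880`). [cite: Silverman1994, IV.11.1] -/
theorem factorization_conductorNorm_T37B1 :
    haveI := isElliptic_T37B1
    (((⟨0, -7, 1, -1127, 17064⟩ : WeierstrassCurve ℚ).conductorNorm ℤ).factorization 7 = 2) ∧
      (((⟨0, -7, 1, -1127, 17064⟩ : WeierstrassCurve ℚ).conductorNorm ℤ).factorization 37 = 1) := by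
  haveI := isElliptic_T37B1; haveI := isGloballyMinimal_T37B1
  haveI hE : ((⟨0, -7, 1, -1127, 17064⟩ : WeierstrassCurve ℤ).baseChange ℚ).IsElliptic := by rw [baseChange_int_T37B1]; infer_instance
  have h7 : Nat.Prime 7 := by norm_num
  have hN : Nat.Prime 37 := by norm_num
  refine ⟨?_, ?_⟩
  · rw [show (7 : ℕ) = ((⟨7, h7⟩ : Nat.Primes) : ℕ) from rfl, factorization_conductorNorm_primesEquiv_symm]
    exact conductorExponent_seven_T37B1 _ (congrArg Subtype.val ((primesEquiv (R := ℤ)).apply_symm_apply ⟨7, h7⟩))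
  · set v : HeightOneSpectrum ℤ := (primesEquiv (R := ℤ)).symm ⟨37, hN⟩ with hv
    have hgen : natGenerator v = 37 := congrArg Subtype.val ((primesEquiv (R := ℤ)).apply_symm_apply ⟨37, hN⟩)
    have hmin : ((⟨0, -7, 1, -1127, 17064⟩ : WeierstrassCurve ℤ).baseChange ℚ).IsMinimalAt v := by
      rw [baseChange_int_T37B1]; exact IsGloballyMinimal.isMinimalAt_int _ v
    have h1 : ((⟨0, -7, 1, -1127, 17064⟩ : WeierstrassCurve ℤ).baseChange ℚ).conductorExponent v = 1 :=
      conductorExponent_eq_one_of_dvd_Δ_of_not_dvd_c₄ hmin (by rw [hgen, MT37B1_Δ]; decide) (by rw [hgen, MT37B1_c₄]; decide)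
    rw [baseChange_int_T37B1] at h1
    rw [show (37 : ℕ) = ((⟨37, hN⟩ : Nat.Primes) : ℕ) from rfl, factorization_conductorNorm_primesEquiv_symm]
    exact h1

/-- **`N(T′) = 1813 = 7²·37` IN THE KERNEL** (`N ∣ 7⁶·37^3`, `ord₇ N = 2`, `ord_37 N = 1`). [cite: CremonaAlgorithms1997, Table 1 (conductor 1813)] -/
theorem conductorNorm_T37B1 :
    haveI := isElliptic_T37B1
    (⟨0, -7, 1, -1127, 17064⟩ : WeierstrassCurve ℚ).conductorNorm ℤ = 1813 := by
  haveI := isElliptic_T37B1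
  set M := (⟨0, -7, 1, -1127, 17064⟩ : WeierstrassCurve ℚ).conductorNorm ℤ with hM
  have hM0 : M ≠ 0 := (conductorNorm_pos_holds _).ne'
  obtain ⟨h7, hN⟩ := factorization_conductorNorm_T37B1
  have hle := (Nat.factorization_le_iff_dvd hM0 (by norm_num : (5959274797 : ℕ) ≠ 0)).mpr conductorNorm_dvd_T37B1
  have eN : (1813 : ℕ) = 7 ^ 2 * 37 ^ 1 := by norm_num
  have eΔ : (5959274797 : ℕ) = 7 ^ 6 * 37 ^ 3 := by norm_num
  refine Nat.eq_of_factorization_eq hM0 (by norm_num) fun q => ?_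
  rw [eN, KrizLiAnchor37a1.factorization_seven_pow_mul_thirtyseven_pow]
  by_cases hq7 : q = 7
  · subst hq7; rw [h7]; simp
  by_cases hqN : q = 37
  · subst hqN; rw [hN]; simp
  have hq' := hle q
  rw [eΔ, KrizLiAnchor37a1.factorization_seven_pow_mul_thirtyseven_pow, if_neg hq7, if_neg hqN] at hq'
  rw [if_neg hq7, if_neg hqN]
  exact Nat.le_zero.mp hq'

/-- **`N(T′) < 5000`** (Creutz–Miller's range). [cite: CreutzMiller2012, Thm. 1.1] -/
theorem conductorNorm_lt_5000_T37B1 :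
    haveI := isElliptic_T37B1
    (⟨0, -7, 1, -1127, 17064⟩ : WeierstrassCurve ℚ).conductorNorm ℤ < 5000 := by
  rw [conductorNorm_T37B1]; norm_num

end Partner37B1

/-! ## §3 The packet witness `ℓ = 53`: `#Ẽ(𝔽_53) = 57` (`a_53 = -3` odd) -/
section Witness37B1

/-- **`#Ẽ(𝔽_53) = 57` for `37b1`** (certified count; `53 ∤ Δ = 50653`), so `a_53 = 54 − 57 = -3`. [cite: SilvermanAEC2009, V.2] -/
theorem reductionPointCount_53_37B1 :
    haveI := isGloballyMinimal_37B1
    (⟨0, 1, 1, -23, -50⟩ : WeierstrassCurve ℚ).reductionPointCount 53 = 57 := by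
  haveI : Fact (Nat.Prime 53) := ⟨by norm_num⟩
  haveI := isElliptic_37B1; haveI := isGloballyMinimal_37B1
  exact Supersingular.reductionPointCount_eq_of_intModel_countPoints intModel_37B1 53 (by norm_num) (by decide +kernel)
    (by decide +kernel)

/-- **`a_53(37b1)` is odd** (`= -3`: `Frob_53` has order `3` on `E[2]`). [cite: KrizLi2019, Def. 4.1 ("Frob_ℓ of order 3")] -/
theorem odd_frobeniusTrace_53_37B1 :
    haveI := isGloballyMinimal_37B1
    Odd ((⟨0, 1, 1, -23, -50⟩ : WeierstrassCurve ℚ).frobeniusTrace 53) := by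
  haveI := isGloballyMinimal_37B1
  rw [Uniform.U2.odd_frobeniusTrace_iff_odd_reductionPointCount _ (by norm_num : Nat.Prime 53) (by norm_num),
    reductionPointCount_53_37B1]
  decide

end Witness37B1

end Summit.BirchSwinnertonDyer.BirchSwinnertonDyer.Theorems.GenusExact.TwinSwap.KrizLiAnchor37b1

end
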